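import Summits.QuantumFields.YangMills.Theorems.IR.ShellMaxCorrSupports

/-!
# Crux `IR` (item stmt-QuantumFields-19354) — line «maximal correlation at one physical thickness»:
THE ENGINE `stub_shellEngine : ShellEngine` (registered stub, lead prover ym-ir-line-mxc-p1)

`--supports stmt-QuantumFields-19354` (stub credit for `ShellMaxCorr.stub_shellEngine`; the file closes no item: the line's
load `IRShellCorr` — the weak-coupling certificate itself — is open and NOT claimed).

**Statement proved** (`Theorems/IR/ShellMaxCorrDefs.lean`): `ShellEngine` — for every compact group `G` with a lattice
representation `r` (hence compact metrisable) and every positive unit map `a → 0`, a shell maximal-correlation certificate at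
ONE physical thickness (`ShellCertificate r a`: some `K₀ > 0`, `θ < 1`, and for all large `β` and all large odd tori, the
Hirschfeld–Gebelein–Rényi maximal correlation of the torus Wilson state between the links of the sup-ball `B_R` and the links
outside `B_{R + ⌈K₀/aβ⌉}` is `≤ θ` for EVERY `R`) implies the volume-uniform lattice mass gap in units `a`
(`DlrCollarTransfer.GapInUnits G r a`, the conclusion of the route decl `BalabanLadder.IR`) with rate
`c₁ = |log max(θ,½)| / (6 K₀)`.

**Proof** (annulus-gluing transfer, all inputs landed in this directory):
* §8 `abs_corr_le_of_shellCert` / `abs_latticeConnectedCorr_le_of_shellCert`: on one torus, the certificate at thickness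
  `s₀` gives, by the doubling law and its iteration (`ShellMaxCorrDoubling`: Markov layer `ShellMaxCorrMarkov` + Hilbert
  product), `|⟨A τ_n B⟩ − ⟨A⟩⟨B⟩| ≤ C_A C_B θ₁^{2^⌊log₂((t+1)/(s₀+1))⌋} ≤ C_A C_B exp(log θ₁ (n+1−r_A−r_B)/(2s₀+2))` for
  `t = n − r_A − r_B ≥ s₀`, using the supports of `ShellMaxCorrSupports` and translation invariance of the torus state
  (`integral_comp_configShift_torusLift`) for the unshifted factor of `latticeConnectedCorr`;
* §9 `rate_bound_large` / `rate_bound_small` (real arithmetic with `s₀ = ⌈K₀/aβ⌉`, `aβ ≤ K₀` eventually since `a → 0`)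
  and the assembly `stub_shellEngine`: constant `C = 2 C_A C_B exp(c₁ K₀ (r_A + r_B + 2))`, thresholds `β ≥ max β₂ β₃`,
  `S ≥ S₁ β` (the certificate's own).

Group-blind (no simplicity of `G`), no smallness beyond `θ < 1`, no boundary datum.  HONEST FRAMING: the EASY half of a
CONDITIONAL rung line for ONE open gap-crux; the Clay Yang–Mills mass gap is NOT proved here or by this line; R4 closes
only the finite-𝕋⁴ UV rung `BalabanLadder.UV`.

Refs: Bradley, *Basic properties of strong mixing conditions*, Probab. Surveys 2 (2005) §1 (ρ-mixing, maximal
correlation); Kesten, *Percolation theory for mathematicians* (1982) Ch. 6 (the annulus-doubling analogue).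
-/

set_option autoImplicit false

noncomputable section

open Filter Topology MeasureTheory ProbabilityTheory
open Literature.MathematicalPhysics.QuantumFieldTheory Literature.MathematicalPhysics.QuantumLattice
open Literature.Probability.LatticeModels (Torus.proj)
open Summit.QuantumFields.YangMills.Cruxes.OSLegsFromFemtoAndGap.DlrCollarTransfer (GapInUnits LowerBounds)

namespace Summit.QuantumFields.YangMills.Cruxes.IR.ShellMaxCorr

/-! ## §8 The engine: `ShellCertificate r a → GapInUnits G r a` -/

section Engine

variable {G : Type} [Group G] [TopologicalSpace G] [IsTopologicalGroup G] [CompactSpace G]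
  [MeasurableSpace G] [BorelSpace G]

/-- **Covariance decay from a shell certificate** (one torus): if `Ψ(s₀) ≤ θ₁` (`0 ≤ θ₁`), then for bounded measurable
`f` reading only links of `B_{r}` and `g` reading only links outside the open ball of radius `r + t`, `t ≥ s₀`,
`|∫ f g − ∫ f ∫ g| ≤ C_f C_g θ₁^(2^⌊log₂((t+1)/(s₀+1))⌋)`. -/
theorem abs_corr_le_of_shellCert [T2Space G] [SecondCountableTopology G] {m : ℕ}
    (ρ : G →* Matrix (Fin m) (Fin m) ℂ) (hρ : Continuous ρ) (β : ℝ) (S s₀ : ℕ) {θ₁ : ℝ}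
    (hθ0 : 0 ≤ θ₁) (hcert : ShellCert ρ β S s₀ θ₁)
    {f g : GaugeConfig 4 (2 * S + 1) G → ℝ} (hfm : Measurable f) (hgm : Measurable g)
    {Cf Cg : ℝ} (hfC : ∀ U, |f U| ≤ Cf) (hgC : ∀ U, |g U| ≤ Cg) (hCf0 : 0 ≤ Cf) (hCg0 : 0 ≤ Cg)
    {r t : ℕ} (hst : s₀ ≤ t) (hf : DependsOn f {e | InBall r e}) (hg : DependsOn g {e | OutBall (r + t) e}) :
    |(∫ U, f U * g U ∂(wilsonMeasure (d := 4) (L := 2 * S + 1) ρ β)) -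
        (∫ U, f U ∂(wilsonMeasure (d := 4) (L := 2 * S + 1) ρ β)) *
          (∫ U, g U ∂(wilsonMeasure (d := 4) (L := 2 * S + 1) ρ β))| ≤
      Cf * Cg * θ₁ ^ (2 ^ Nat.log 2 ((t + 1) / (s₀ + 1))) := by
  haveI : IsProbabilityMeasure (wilsonMeasure (d := 4) (L := 2 * S + 1) ρ β) :=
    isProbabilityMeasure_wilsonMeasure (d := 4) (L := 2 * S + 1) ρ hρ β
  have hdec := shellCert_of_le ρ hρ β S hθ0 hcert hst r f g hfm hgm ⟨Cf, hfC⟩ ⟨Cg, hgC⟩ hf hg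
  rw [cov_eq_integral _ hfm hfC hgm hgC] at hdec
  refine hdec.trans ?_
  have hσf := sqrt_variance_le (wilsonMeasure (d := 4) (L := 2 * S + 1) ρ β) hfm hfC hCf0
  have hσg := sqrt_variance_le (wilsonMeasure (d := 4) (L := 2 * S + 1) ρ β) hgm hgC hCg0
  have hp0 : 0 ≤ θ₁ ^ (2 ^ Nat.log 2 ((t + 1) / (s₀ + 1))) := pow_nonneg hθ0 _
  calc θ₁ ^ 2 ^ Nat.log 2 ((t + 1) / (s₀ + 1)) *
        Real.sqrt (Var[f; wilsonMeasure (d := 4) (L := 2 * S + 1) ρ β]) *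
          Real.sqrt (Var[g; wilsonMeasure (d := 4) (L := 2 * S + 1) ρ β])
      ≤ θ₁ ^ 2 ^ Nat.log 2 ((t + 1) / (s₀ + 1)) * Cf * Cg := by gcongr
    _ = Cf * Cg * θ₁ ^ 2 ^ Nat.log 2 ((t + 1) / (s₀ + 1)) := by ring

/-- The iterated-doubling factor is an exponential in the thickness:
`θ₁^(2^⌊log₂((t+1)/(s₀+1))⌋) ≤ exp(log θ₁ · (t+1)/(2 s₀+2))` for `0 < θ₁ ≤ 1`. -/
theorem pow_two_pow_log_le_exp {θ₁ : ℝ} (hθ0 : 0 < θ₁) (hθ1 : θ₁ ≤ 1) (s₀ t : ℕ) :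
    θ₁ ^ (2 ^ Nat.log 2 ((t + 1) / (s₀ + 1))) ≤
      Real.exp (Real.log θ₁ * (((t : ℝ) + 1) / (2 * ((s₀ : ℝ) + 1)))) := by
  rw [← Real.rpow_natCast, Real.rpow_def_of_pos hθ0]
  refine Real.exp_le_exp.2 ?_
  have hlog : Real.log θ₁ ≤ 0 := Real.log_nonpos hθ0.le hθ1
  have h2 := div_le_two_pow_log s₀ t
  push_cast
  exact mul_le_mul_of_nonpos_left h2 hlog

/-- **Clustering from a shell certificate, one torus at a time.**  On the torus of side `2S+1` (compact metrisable `G`,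
continuous `ρ`): if `Ψ(s₀) ≤ θ₁` with `0 < θ₁ ≤ 1`, then for local observables `A, B` with support radii `r_A, r_B`
(`exists_radius_dependsOn_inBall/outBall`) and sup bounds `C_A, C_B`, for every time separation `n ≤ S` with
`r_A + r_B + s₀ ≤ n`,
`|⟨A τ_n B⟩ − ⟨A⟩⟨B⟩| ≤ C_A C_B · exp(log θ₁ · (n + 1 − r_A − r_B) / (2 s₀ + 2))`. -/
theorem abs_latticeConnectedCorr_le_of_shellCert [T2Space G] [SecondCountableTopology G] {m : ℕ}
    (ρ : G →* Matrix (Fin m) (Fin m) ℂ) (hρ : Continuous ρ) (β : ℝ) (S s₀ : ℕ) {θ₁ : ℝ}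
    (hθ0 : 0 < θ₁) (hθ1 : θ₁ ≤ 1) (hcert : ShellCert ρ β S s₀ θ₁)
    (A B : LocalGaugeObservable 4 G) {rA rB : ℕ} {CA CB : ℝ}
    (hA : ∀ (N : ℕ) [NeZero N], DependsOn (fun U : GaugeConfig 4 N G => A.F (torusLift N U)) {e | InBall rA e})
    (hB : ∀ (S n : ℕ), n ≤ S → DependsOn (fun U : GaugeConfig 4 (2 * S + 1) G =>
        B.F (configShift (-Pi.single 0 (n : ℤ)) (torusLift (2 * S + 1) U))) {e | OutBall (n - rB) e})
    (hCA : ∀ U, |A.F U| ≤ CA) (hCB : ∀ U, |B.F U| ≤ CB)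
    {n : ℕ} (hnS : n ≤ S) (hn : rA + rB + s₀ ≤ n) :
    |latticeConnectedCorr ρ β (2 * S + 1) A.F B.F n| ≤
      CA * CB * Real.exp (Real.log θ₁ * (((n : ℝ) + 1 - rA - rB) / (2 * ((s₀ : ℝ) + 1)))) := by
  have hfm : Measurable (fun U : GaugeConfig 4 (2 * S + 1) G => A.F (torusLift (2 * S + 1) U)) :=
    A.measurable.comp (measurable_torusLift (2 * S + 1))
  have hgm : Measurable (fun U : GaugeConfig 4 (2 * S + 1) G =>
      B.F (configShift (-Pi.single 0 (n : ℤ)) (torusLift (2 * S + 1) U))) :=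
    B.measurable.comp ((configShift _).measurable.comp (measurable_torusLift _))
  have hCA0 : 0 ≤ CA := (abs_nonneg _).trans (hCA (fun _ => 1))
  have hCB0 : 0 ≤ CB := (abs_nonneg _).trans (hCB (fun _ => 1))
  have hst : s₀ ≤ n - rB - rA := by omega
  have hRt : rA + (n - rB - rA) = n - rB := by omega
  have key := abs_corr_le_of_shellCert ρ hρ β S s₀ hθ0.le hcert hfm hgm (fun U => hCA _) (fun U => hCB _)
    hCA0 hCB0 hst (hA (2 * S + 1)) (by rw [hRt]; exact hB S n hnS)
  have hexp := pow_two_pow_log_le_exp hθ0 hθ1 s₀ (n - rB - rA)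
  have ht1 : (((n - rB - rA : ℕ) : ℝ) + 1) = (n : ℝ) + 1 - rA - rB := by
    rw [Nat.cast_sub (by omega : rA ≤ n - rB), Nat.cast_sub (by omega : rB ≤ n)]; ring
  rw [ht1] at hexp
  unfold latticeConnectedCorr
  rw [← integral_comp_configShift_torusLift ρ β B.F (-Pi.single 0 (n : ℤ))]
  exact key.trans (mul_le_mul_of_nonneg_left hexp (mul_nonneg hCA0 hCB0))

end Engine


/-! ## §9 Rate arithmetic and the registered stub `stub_shellEngine` -/

section Assembly

/-- Exponent bookkeeping, large separations: with `λ = −log θ₁ > 0`, unit `ab = a β ≤ K₀`, certified thickness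
`s₀ < K₀/ab + 1` and `n ≥ r_A + r_B + s₀`,
`−λ (n+1−r_A−r_B)/(2 s₀+2) ≤ (λ/(6K₀)) K₀ (r_A+r_B+2) − (λ/(6K₀)) ab n`. -/
theorem rate_bound_large {lam K₀ ab : ℝ} {s₀ n rA rB : ℕ} (hlam : 0 < lam) (hK : 0 < K₀) (hab : 0 < ab)
    (habK : ab ≤ K₀) (hs₀ : (s₀ : ℝ) < K₀ / ab + 1) (hn : rA + rB + s₀ ≤ n) :
    -lam * ((((n : ℝ) + 1 - rA - rB)) / (2 * ((s₀ : ℝ) + 1))) ≤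
      lam / (6 * K₀) * K₀ * ((rA : ℝ) + rB + 2) - lam / (6 * K₀) * ab * n := by
  have hX0 : 0 ≤ ((n : ℝ) + 1 - rA - rB) := by
    have : ((rA + rB + s₀ : ℕ) : ℝ) ≤ n := by exact_mod_cast hn
    push_cast at this; linarith
  have hD : 0 < 2 * ((s₀ : ℝ) + 1) := by positivity
  have hs₀ab : (s₀ : ℝ) * ab < K₀ + ab := by
    have h1 : ((s₀ : ℝ) - 1) < K₀ / ab := by linarith
    have h2 := (lt_div_iff₀ hab).1 h1
    linarith
  have hDab : ab * (2 * ((s₀ : ℝ) + 1)) ≤ 6 * K₀ := by nlinarith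
  -- `ab/(6K₀) ≤ 1/D`
  have hfrac : ab / (6 * K₀) ≤ 1 / (2 * ((s₀ : ℝ) + 1)) := by
    rw [div_le_div_iff₀ (by positivity) hD]; linarith
  have hstep1 : -lam * (((n : ℝ) + 1 - rA - rB) / (2 * ((s₀ : ℝ) + 1))) ≤
      -(lam / (6 * K₀) * ab * ((n : ℝ) + 1 - rA - rB)) := by
    have h := mul_le_mul_of_nonneg_left hfrac (mul_nonneg hlam.le hX0)
    have e1 : lam * ((n : ℝ) + 1 - rA - rB) * (1 / (2 * ((s₀ : ℝ) + 1))) =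
        lam * (((n : ℝ) + 1 - rA - rB) / (2 * ((s₀ : ℝ) + 1))) := by ring
    have e2 : lam * ((n : ℝ) + 1 - rA - rB) * (ab / (6 * K₀)) =
        lam / (6 * K₀) * ab * ((n : ℝ) + 1 - rA - rB) := by ring
    linarith [h, e1, e2]
  have hstep2 : lam / (6 * K₀) * ab * ((rA : ℝ) + rB - 1) ≤ lam / (6 * K₀) * K₀ * ((rA : ℝ) + rB + 2) := by
    have hc : 0 ≤ lam / (6 * K₀) := by positivity
    have h1 : ab * ((rA : ℝ) + rB - 1) ≤ K₀ * ((rA : ℝ) + rB + 2) := by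
      have hr : 0 ≤ (rA : ℝ) + rB := by positivity
      nlinarith
    calc lam / (6 * K₀) * ab * ((rA : ℝ) + rB - 1) = lam / (6 * K₀) * (ab * ((rA : ℝ) + rB - 1)) := by ring
      _ ≤ lam / (6 * K₀) * (K₀ * ((rA : ℝ) + rB + 2)) := mul_le_mul_of_nonneg_left h1 hc
      _ = lam / (6 * K₀) * K₀ * ((rA : ℝ) + rB + 2) := by ring
  have e3 : -(lam / (6 * K₀) * ab * ((n : ℝ) + 1 - rA - rB)) =
      lam / (6 * K₀) * ab * ((rA : ℝ) + rB - 1) - lam / (6 * K₀) * ab * n := by ring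
  linarith

/-- Exponent bookkeeping, small separations: for `n < r_A + r_B + s₀`,
`0 ≤ (λ/(6K₀)) K₀ (r_A+r_B+2) − (λ/(6K₀)) ab n`. -/
theorem rate_bound_small {lam K₀ ab : ℝ} {s₀ n rA rB : ℕ} (hlam : 0 < lam) (hK : 0 < K₀) (hab : 0 < ab)
    (habK : ab ≤ K₀) (hs₀ : (s₀ : ℝ) < K₀ / ab + 1) (hn : n < rA + rB + s₀) :
    0 ≤ lam / (6 * K₀) * K₀ * ((rA : ℝ) + rB + 2) - lam / (6 * K₀) * ab * n := by
  have hc : 0 ≤ lam / (6 * K₀) := by positivity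
  have hs₀ab : (s₀ : ℝ) * ab < K₀ + ab := by
    have h1 : ((s₀ : ℝ) - 1) < K₀ / ab := by linarith
    have h2 := (lt_div_iff₀ hab).1 h1
    linarith
  have hn' : (n : ℝ) ≤ (rA : ℝ) + rB + s₀ := by
    have : ((n : ℕ) : ℝ) ≤ ((rA + rB + s₀ : ℕ) : ℝ) := by exact_mod_cast hn.le
    push_cast at this; exact this
  have h1 : ab * (n : ℝ) ≤ K₀ * ((rA : ℝ) + rB + 2) := by
    have hr : 0 ≤ (rA : ℝ) + rB := by positivity
    nlinarith
  have := mul_le_mul_of_nonneg_left h1 hc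
  nlinarith

variable {G : Type} [Group G] [TopologicalSpace G] [IsTopologicalGroup G] [CompactSpace G]

/-- **THE ENGINE (registered stub `stub_shellEngine` of the line «maximal correlation at one physical thickness»,
crux `IR` = stmt-QuantumFields-19354).**  A shell maximal-correlation certificate at ONE physical thickness
(`ShellCertificate r a`: `Ψ_β(⌈K₀/a β⌉) ≤ θ < 1` for all large `β` and tori, uniformly in the inner radius) gives the
volume-uniform lattice mass gap in units `a` (`GapInUnits G r a`), with rate `c₁ = |log max(θ,½)| / (6 K₀)`: the Markov
property of the plaquette action across one sphere layer and the Hilbert-space product bound give the doubling law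
`Ψ(2s+1) ≤ Ψ(s)²` (`shellCert_double`), iteration gives `Ψ(t) ≤ θ^{(t+1)/(2s₀+2)}` (`shellCert_of_le`,
`div_le_two_pow_log`), and the supports of `A` and of `τ_n B` through the periodic lift sit in `B_{r_A}` and outside the
open ball of radius `n − r_B` (`exists_radius_dependsOn_inBall/outBall`).  Group-blind; no smallness beyond `θ < 1`.
HONEST FRAMING: this is the EASY half of the line; the certificate itself (`IRShellCorr`) is the open load. -/
theorem stub_shellEngine : ShellEngine := by
  intro G _ _ _ _ r a ha ha0 hcert
  letI : MeasurableSpace G := borel G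
  haveI : BorelSpace G := ⟨rfl⟩
  haveI : SecondCountableTopology G :=
    (r.continuous.isClosedEmbedding r.injective).isEmbedding.secondCountableTopology
  haveI : T2Space G := (r.continuous.isClosedEmbedding r.injective).isEmbedding.t2Space
  obtain ⟨K₀, θ, β₂, S₁, hK₀, hθ0, hθ1, hc⟩ := hcert
  -- a certificate constant in `[1/2, 1)`
  set θ₁ : ℝ := max θ (1 / 2) with hθ₁
  have hθ₁pos : 0 < θ₁ := lt_of_lt_of_le one_half_pos (le_max_right _ _)
  have hθ₁lt : θ₁ < 1 := max_lt hθ1 one_half_lt_one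
  have hθθ₁ : θ ≤ θ₁ := le_max_left _ _
  have hlogneg : Real.log θ₁ < 0 := Real.log_neg hθ₁pos hθ₁lt
  -- eventually `a β ≤ K₀`
  obtain ⟨β₃, hβ₃⟩ : ∃ β₃ : ℝ, ∀ β, β₃ ≤ β → a β ≤ K₀ :=
    eventually_atTop.1 (ha0.eventually (eventually_le_nhds hK₀))
  set c₁ : ℝ := -Real.log θ₁ / (6 * K₀) with hc₁
  have hlam : 0 < -Real.log θ₁ := neg_pos.2 hlogneg
  have hc₁pos : 0 < c₁ := div_pos hlam (by positivity)
  refine ⟨c₁, max β₂ β₃, S₁, hc₁pos, fun A B => ?_⟩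
  obtain ⟨rA, hA⟩ := exists_radius_dependsOn_inBall A
  obtain ⟨rB, hB⟩ := exists_radius_dependsOn_outBall B
  obtain ⟨CA, hCA⟩ := A.bounded
  obtain ⟨CB, hCB⟩ := B.bounded
  have hCA0 : 0 ≤ CA := (abs_nonneg _).trans (hCA (fun _ => 1))
  have hCB0 : 0 ≤ CB := (abs_nonneg _).trans (hCB (fun _ => 1))
  refine ⟨2 * CA * CB * Real.exp (c₁ * K₀ * ((rA : ℝ) + rB + 2)), fun β hβ S n hS hn => ?_⟩
  have hβ₂ : β₂ ≤ β := (le_max_left _ _).trans hβ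
  have hab : 0 < a β := ha β
  have habK : a β ≤ K₀ := hβ₃ β ((le_max_right _ _).trans hβ)
  set s₀ : ℕ := ⌈K₀ / a β⌉₊ with hs₀
  have hs₀lt : (s₀ : ℝ) < K₀ / a β + 1 := Nat.ceil_lt_add_one (by positivity)
  have hcert' : ShellCert r.ρ β S s₀ θ₁ := shellCert_mono le_rfl hθθ₁ (hc β hβ₂ S hS)
  haveI : IsProbabilityMeasure (wilsonMeasure (d := 4) (L := 2 * S + 1) r.ρ β) :=
    isProbabilityMeasure_wilsonMeasure (d := 4) (L := 2 * S + 1) r.ρ r.continuous β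
  -- the target, with the constant split as `2 C_A C_B · exp(c₁ K₀ (r_A + r_B + 2) − c₁ aβ n)`
  have hsplit : 2 * CA * CB * Real.exp (c₁ * K₀ * ((rA : ℝ) + rB + 2)) * Real.exp (-(c₁ * a β * n)) =
      2 * CA * CB * Real.exp (c₁ * K₀ * ((rA : ℝ) + rB + 2) - c₁ * a β * n) := by
    rw [sub_eq_add_neg, Real.exp_add]; ring
  rw [hsplit]
  by_cases hcase : rA + rB + s₀ ≤ n
  · -- large separations: the certificate
    have h := abs_latticeConnectedCorr_le_of_shellCert r.ρ r.continuous β S s₀ hθ₁pos hθ₁lt.le hcert'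
      A B hA hB hCA hCB hn hcase
    refine h.trans ?_
    have hrate := rate_bound_large (s₀ := s₀) (n := n) (rA := rA) (rB := rB) hlam hK₀ hab habK hs₀lt hcase
    have hexp : Real.exp (Real.log θ₁ * (((n : ℝ) + 1 - rA - rB) / (2 * ((s₀ : ℝ) + 1)))) ≤
        Real.exp (c₁ * K₀ * ((rA : ℝ) + rB + 2) - c₁ * a β * n) := by
      refine Real.exp_le_exp.2 ?_
      have e : Real.log θ₁ * (((n : ℝ) + 1 - rA - rB) / (2 * ((s₀ : ℝ) + 1))) =
          -(-Real.log θ₁) * (((n : ℝ) + 1 - rA - rB) / (2 * ((s₀ : ℝ) + 1))) := by ring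
      rw [e, hc₁]; exact hrate
    calc CA * CB * Real.exp (Real.log θ₁ * (((n : ℝ) + 1 - rA - rB) / (2 * ((s₀ : ℝ) + 1))))
        ≤ CA * CB * Real.exp (c₁ * K₀ * ((rA : ℝ) + rB + 2) - c₁ * a β * n) :=
          mul_le_mul_of_nonneg_left hexp (mul_nonneg hCA0 hCB0)
      _ ≤ 2 * CA * CB * Real.exp (c₁ * K₀ * ((rA : ℝ) + rB + 2) - c₁ * a β * n) := by
          have : 0 ≤ CA * CB * Real.exp (c₁ * K₀ * ((rA : ℝ) + rB + 2) - c₁ * a β * n) :=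
            mul_nonneg (mul_nonneg hCA0 hCB0) (Real.exp_nonneg _)
          linarith
  · -- small separations: the trivial bound
    rw [not_le] at hcase
    have hrate := rate_bound_small (s₀ := s₀) (n := n) (rA := rA) (rB := rB) hlam hK₀ hab habK hs₀lt hcase
    have htriv : |latticeConnectedCorr r.ρ β (2 * S + 1) A.F B.F n| ≤ 2 * CA * CB := by
      unfold latticeConnectedCorr
      rw [← integral_comp_configShift_torusLift r.ρ β B.F (-Pi.single 0 (n : ℤ))]
      exact abs_corr_le_two_mul _ (fun U => hCA _) (fun U => hCB _) hCA0
    refine htriv.trans ?_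
    have h1 : 1 ≤ Real.exp (c₁ * K₀ * ((rA : ℝ) + rB + 2) - c₁ * a β * n) := by
      rw [hc₁]
      exact Real.one_le_exp hrate
    have h0 : 0 ≤ 2 * CA * CB := by positivity
    nlinarith

end Assembly

end Summit.QuantumFields.YangMills.Cruxes.IR.ShellMaxCorr

end
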